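import Mathlib
import Literature.NumberTheory.Sieve.RamanujanSum
import HarnessLib

/-!
# Bondarenko–Heap 2026, §6: the off-diagonal correlation sums `E(K,M,R)` —
# Lemmas 7–10 and the three ranges (23), (27), (40) behind Proposition 6

Topic `Literature/NumberTheory/LFunctions`, namespace
`Literature.NumberTheory.LFunctions.BondarenkoHeap2026` (paper-internal objects). STATEMENT LAYER,
RH-FREE: every statement of §6 of A. Bondarenko, W. Heap, *Siegel zeros and small gaps between
zeros of the Riemann zeta function*, arXiv:2608.07399v1 (Aug 2026) — authors' TeX of record
`Siegel_zeros_and_small_gaps_v5.tex` (sha256/16 `c55a127ba83d8949`), lines 742–1309, printed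
pp. 15–26 — is a bound for finite character sums; none mentions `ζ`, RH or a Siegel zero. Unproved
displays of the unrefereed preprint are NAMED FACTS `def … : Prop` tagged
`[claim: BondarenkoHeap2026, status: under-review]` (D-0012/D-0014); bookkeeping is PROVED.

## What §6 does (TeX l.742–853)

Proposition 6 (`𝒪𝒟 = o(T φ(q)/q · log T)`, §5, l.644) is reduced in §6.2 — dyadic partition in
`k, m, r`, separation of variables by Mellin inversion truncated at height `q^ε` — to a power saving
for the trilinear correlation sum (l.840)
`E(K,M,R) := ∑_k a_k Λ(k) ∑_{m,r} b_m c_r χ(m) χ(km + r)`,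
"where `a, b, c` are complex valued 1-bounded smooth functions supported on `[K,2K]`, `[M,2M]`,
`[R,2R]`, respectively, whose `j`th order derivatives are `≪ q^ε`" (l.834), `χ` the primitive
quadratic character modulo the fundamental discriminant `q`, `T = q^{7/3+δ}`, `L = q^{17/6}`,
`R ≪ KM/T`, `KM ≪ L` (l.766), `η = δ/10` (l.853); the case `r > 0` is treated, "the argument for
`r < 0` being similar" (l.749). Three ranges of `K` (l.854–860):
(20) I: `K ≤ Tq^{−1/2−η}`; (21) II: `Tq^{−1/2−η} < K ≤ Tq^{−η}`; (22) III: `K ≥ q^{7/3+2η}`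
(II and III overlap), with savings (23) `q^{−η/2}` [Lemma 4 + (16)], (27) `q^{−η/4}`
[Cauchy–Schwarz (24) + Lemmas 7, 8], (40) `q^{−δ/2}` [(28) + Lemmas 9, 10]; "Combining the power
savings from all three ranges: (23), (27) and (40) gives Proposition 6" (l.1309).

## Rendering (read with each docstring)

1. *Weights.* `IsSmoothDyadicWeight X A Q a`: `a : ℝ → ℂ` smooth, `a x ≠ 0 → X ≤ x ≤ 2X`,
   `‖a‖_∞ ≤ 1`, and `‖a^{(j)}(x)‖ ≤ A_j · Q · X^{−j}` for all `j` — the SCALED reading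
   `a_k = V(k/K)`, `‖V^{(j)}‖_∞ ≪_j q^ε` which the text adopts (l.836, "this form will be
   preferable") and which Lemma 4 (`‖V‖_BV ≪ q^ε`) and Lemma 10 consume; `A : ℕ → ℝ` are the
   constants implicit in `≪_j`, `Q = q^{ε₁}`.
2. *Sums.* `k, m, r` run over the boxes `1 ≤ · ≤ ⌊2X⌋` (which contain the supports); `r ≍ R`,
   `m ≍ M`, `k ≍ K` in Lemmas 7–10 are the dyadic boxes `[X, 2X]` of §6.2 (l.834). The sign of
   `r` is a parameter `s ∈ {1, −1}`: the summand is `χ(m) χ(km + s·r)`, `r ∈ [R, 2R]`.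
3. *`q^ε`-convention.* "`≪_ε q^ε` for every `ε > 0`, hypotheses' `ε` as small as needed" is
   typed `∀ ε > 0, ∃ ε₁ > 0, …, (hypotheses with q^{ε₁}) → (conclusion with q^{ε})`, and implied
   constants as `∃ C` after the data they may depend on (`∀ A, ∃ C`: "`≪_j`"). Bounds printed for
   `q → ∞` along fundamental discriminants are typed for every `q ≥ 1` carrying a primitive
   quadratic character (finitely many small `q` are absorbed by `C`: all sums are finite and the
   scales are `≤ C₀ q^{17/6}`).
4. *Characters.* "`q` a fundamental discriminant, `χ` the primitive quadratic character mod `q`"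
   = `χ : DirichletCharacter ℂ q`, `χ.IsPrimitive`, `χ.IsQuadratic` (as in the tree's
   `Literature.Barriers.Parity.IsSiegelZero`). `ψ̄(u)` = `conj (ψ u)`; `m̄` = `(m : ZMod q)⁻¹`.
5. *Lemma 9 data* (29): for square-free `q`, `ψ_p = χ_p ⟺ p ∤ cond(χψ̄)`, so `q_ψ = cond(χψ̄)`,
   `s_ψ = q / q_ψ`, `λ_ψ` = the primitive character inducing `χψ̄`; the (undisplayed) Jacobi factor
   `J_{q_ψ}(ψ) = ∏_{p ∣ q_ψ} ∑*_{u mod p} χ_p(u+1) ψ̄_p(u)` (proof, l.1073) is the unique value making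
   (30) hold at `r = m = 1`, namely `μ(s_ψ) · T_ψ(1)` (`c_s(1) = μ(s)`); we define it so.
6. NOT here: `𝒪𝒟`, `J`, `Ŵ_T`, `G`, the parameters (5) as named constants (§2/§5 dictionary,
   files `BondarenkoHeap2026Section2/Sections3to5`); the §6.2 reduction "power saving for `E` ⟹
   `𝒪𝒟 ≪ q^ε T q^{−η}`" and the assembly of Proposition 6 are appended once that dictionary lands.
   Lemma 4, (16) and Proposition 2 (inputs of (23) and of Lemma 10) live in `…Sections3to5`.

## References

* [BondarenkoHeap2026] arXiv:2608.07399v1, §6 (TeX l.742–1309; Lemma 7 l.906, Lemma 8 l.945,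
  Lemma 9 l.1026, Lemma 10 l.1108; (23) l.873, (24) l.899, (27) l.991, (28) l.1019, (40) l.1304).
* [MatomakiRadziwillTao2019] for the tree's `ramanujanSum` (`c_s(r)`).
-/

noncomputable section

open scoped ContDiff ArithmeticFunction.vonMangoldt ArithmeticFunction.Moebius
open Finset

namespace Literature.NumberTheory.LFunctions.BondarenkoHeap2026

open Literature.NumberTheory.Sieve (ramanujanSum)

/-! ### §6.2 objects: weights, the correlation sum `E(K,M,R)`, scales and ranges -/

/-- **Smooth dyadic weight at scale `X`** ("complex valued 1-bounded smooth function supported on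
`[X, 2X]` whose `j`th order derivatives are `≪ q^ε`", read in the scaled form `a_k = V(k/K)`,
`‖V^{(j)}‖_∞ ≪_j q^ε`, l.834–836): `a` is `C^∞`, vanishes off `[X, 2X]`, `‖a x‖ ≤ 1`, and
`‖a^{(j)}(x)‖ ≤ A_j · Q / X^j` for every `j`, `x` (`A` the `≪_j`-constants, `Q` the loss `q^ε`).
[cite: BondarenkoHeap2026, §6.2, TeX l.834–836] -/
def IsSmoothDyadicWeight (X : ℝ) (A : ℕ → ℝ) (Q : ℝ) (a : ℝ → ℂ) : Prop :=
  ContDiff ℝ ∞ a ∧ (∀ x : ℝ, a x ≠ 0 → X ≤ x ∧ x ≤ 2 * X) ∧ (∀ x : ℝ, ‖a x‖ ≤ 1) ∧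
    ∀ (j : ℕ) (x : ℝ), ‖iteratedDeriv j a x‖ ≤ A j * Q / X ^ j

/-- **The correlation sum `E(K,M,R) := ∑_k a_k Λ(k) ∑_{m,r} b_m c_r χ(m) χ(km + r)`** (l.840),
over positive integers `k ≤ 2K`, `m ≤ 2M`, `r ≤ 2R` (boxes containing the supports of the weights),
with the sign of the shift as a parameter: summand `χ(m) χ(km + s·r)`, `s = 1` the printed case
`r > 0`, `s = −1` the case `r < 0` ("similar", l.749). [cite: BondarenkoHeap2026, §6.2, TeX l.840] -/
def corrSumE {q : ℕ} (χ : DirichletCharacter ℂ q) (s : ℤ) (K M R : ℝ) (a b c : ℝ → ℂ) : ℂ :=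
  ∑ k ∈ Icc 1 ⌊2 * K⌋₊, a k * ((Λ k : ℝ) : ℂ) *
    ∑ m ∈ Icc 1 ⌊2 * M⌋₊, ∑ r ∈ Icc 1 ⌊2 * R⌋₊,
      b m * c r * (χ (m : ZMod q) * χ (((k : ℤ) * m + s * r : ℤ) : ZMod q))

/-- **Admissible scales** for the dyadic pieces of `𝒪𝒟` (l.766, with `T = q^{7/3+δ}`,
`L = q^{17/6}` from (5)): `K, M, R ≥ 1` (dyadic sizes of positive integer variables),
`R ≤ C₀·KM/T` ("`R ≪ KM/T`") and `KM ≤ C₀·L` ("`KM ≪ L`"), `C₀` the implied constant.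
[cite: BondarenkoHeap2026, §6.2, TeX l.766–770] -/
def IsAdmissibleScale (q : ℕ) (δ C₀ K M R : ℝ) : Prop :=
  1 ≤ K ∧ 1 ≤ M ∧ 1 ≤ R ∧ R ≤ C₀ * (K * M) / (q : ℝ) ^ (7 / 3 + δ) ∧
    K * M ≤ C₀ * (q : ℝ) ^ (17 / 6 : ℝ)

/-- **Range I** (20): `K ≤ T q^{−1/2−η}`, `T = q^{7/3+δ}`, `η = δ/10` (l.853–855).
[cite: BondarenkoHeap2026, eq. (20), TeX l.855] -/
def InRangeI (δ : ℝ) (q : ℕ) (K : ℝ) : Prop :=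
  K ≤ (q : ℝ) ^ (7 / 3 + δ) * (q : ℝ) ^ (-(1 / 2 + δ / 10))

/-- **Range II** (21): `T q^{−1/2−η} < K ≤ T q^{−η}` (l.857).
[cite: BondarenkoHeap2026, eq. (21), TeX l.857] -/
def InRangeII (δ : ℝ) (q : ℕ) (K : ℝ) : Prop :=
  (q : ℝ) ^ (7 / 3 + δ) * (q : ℝ) ^ (-(1 / 2 + δ / 10)) < K ∧
    K ≤ (q : ℝ) ^ (7 / 3 + δ) * (q : ℝ) ^ (-(δ / 10))

/-- **Range III** (22): `K ≥ q^{7/3+2η}` (l.859); "ranges II and III overlap because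
`7/3 + 2η < 7/3 + δ − η`" (l.861). [cite: BondarenkoHeap2026, eq. (22), TeX l.859] -/
def InRangeIII (δ : ℝ) (q : ℕ) (K : ℝ) : Prop :=
  (q : ℝ) ^ (7 / 3 + 2 * (δ / 10)) ≤ K

/-- **"`E(K,M,R)/KM ≪ q^{−θ}` on a range of `K`"** — the common shape of (23), (27), (40): for the
fixed `δ` and every implied constant `C₀` of the scale restrictions and every family `A` of
derivative constants there are a loss exponent `ε₁ > 0` (the `ε` "taken sufficiently small",
l.845, l.995) and `C` such that for every `q` with a primitive quadratic character `χ`, all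
admissible scales with `K` in the range, both signs of `r` and all weights of loss `q^{ε₁}`,
`|E(K,M,R)| ≤ C · KM · q^{−θ}`. [cite: BondarenkoHeap2026, §6.2, TeX l.838–847] -/
def CorrSumBoundOn (δ θ : ℝ) (inRange : ℕ → ℝ → Prop) : Prop :=
  ∀ C₀ : ℝ, 0 < C₀ → ∀ A : ℕ → ℝ, ∃ ε₁ : ℝ, 0 < ε₁ ∧ ∃ C : ℝ, 0 < C ∧
    ∀ (q : ℕ) [NeZero q] (χ : DirichletCharacter ℂ q), χ.IsPrimitive → χ.IsQuadratic →
    ∀ (K M R : ℝ), IsAdmissibleScale q δ C₀ K M R → inRange q K →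
    ∀ (s : ℤ), (s = 1 ∨ s = -1) → ∀ (a b c : ℝ → ℂ),
      IsSmoothDyadicWeight K A ((q : ℝ) ^ ε₁) a → IsSmoothDyadicWeight M A ((q : ℝ) ^ ε₁) b →
      IsSmoothDyadicWeight R A ((q : ℝ) ^ ε₁) c →
      ‖corrSumE χ s K M R a b c‖ ≤ C * (K * M) * (q : ℝ) ^ (-θ)

/-- **Power saving `q^θ` for `E(K,M,R)` over `KM` on ALL admissible scales** — the output of §6
that the §6.2 reduction turns into `𝒪𝒟 ≪ q^ε T q^{−θ}` (l.838–847).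
[cite: BondarenkoHeap2026, §6.2, TeX l.838–847] -/
def CorrSumPowerSaving (δ θ : ℝ) : Prop :=
  CorrSumBoundOn δ θ fun _ _ => True

/-! ### §6.3–6.5: the three range bounds (23), (27), (40) — named facts -/

/-- **(23), Range I** (§6.3, l.864–878): for `0 < δ < 10^{−2}` (l.361), on admissible scales with
`K ≤ Tq^{−1/2−η}`, `E(K,M,R)/KM ≪ q^{−η/2}`, `η = δ/10` — "Applying Lemma 4 to the sum over `m`,
(16) for the sum over `r` and estimating the sum over `k` trivially … `≪ q^ε(R/q + K√q/T)` … since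
`R ≪ L/T = q^{1/2−δ}` always and `K ≪ Tq^{−1/2−η}`". Named fact (inputs: Lemma 4, (16) of §4).
[claim: BondarenkoHeap2026, status: under-review] -/
def rangeI_bound : Prop :=
  ∀ δ : ℝ, 0 < δ → δ < 1 / 100 → CorrSumBoundOn δ (δ / 10 / 2) (InRangeI δ)

/-- **(27), Range II** (§6.4, l.880–996): for `0 < δ < 10^{−2}`, on admissible scales with
`Tq^{−1/2−η} < K ≤ Tq^{−η}`, `E(K,M,R)/KM ≪ q^{−η/2+ε} + q^{−δ+ε} ≪ q^{−η/4}` "on taking `ε`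
sufficiently small" — from (24) and Lemmas 7, 8, "bounding `Λ(k)²` trivially", `q ≪ K`,
`R/q^{1/2} ≪ q^{−δ}`, `R/M ≪ K/T ≪ q^{−η}`. Named fact.
[claim: BondarenkoHeap2026, status: under-review] -/
def rangeII_bound : Prop :=
  ∀ δ : ℝ, 0 < δ → δ < 1 / 100 → CorrSumBoundOn δ (δ / 10 / 4) (InRangeII δ)

/-- **(40), Range III** (§6.5, l.998–1309): for `0 < δ < 10^{−2}`, on admissible scales with
`K ≥ q^{7/3+2η}`, `E(K,M,R)/KM ≪ (1/KM) q^ε RMK/q^{1/2} ≪ q^{−δ/2}` — "Combining Lemmas 9 and 10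
in (28), and bounding the sum over `k` trivially when `ψ = ψ₀` or `χ`" (the terms with
`(k,q) > 1` being `≪ q^{−1}`, l.1004). Named fact. [claim: BondarenkoHeap2026, status: under-review] -/
def rangeIII_bound : Prop :=
  ∀ δ : ℝ, 0 < δ → δ < 1 / 100 → CorrSumBoundOn δ (δ / 2) (InRangeIII δ)

/-! ### §6.4: Lemma 7 (congruence energy) and Lemma 8 (shifted quadratic character, `L²`) -/

/-- **Lemma 7** (l.906–921). "Let `1 ≤ R ≤ M ≤ q^C`. For arbitrary coefficients `|b_{r,m}| ≤ 1`,
supported on `r ≍ R`, `m ≍ M` and `(m,q) = 1`, put `W_x = ∑_{r,m : r m̄ ≡ x mod q} b_{r,m}`. Then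
(25) `∑_{x mod q} |W_x|² ≪ q^ε (RM + R²M²/q)`." Rendered with the boxes `[R,2R]`, `[M,2M]`
(module docstring, item 2), implied constant depending on `C` and `ε`. Named fact ("essentially an
additive divisor problem"). [claim: BondarenkoHeap2026, status: under-review] -/
def lemma7 : Prop :=
  ∀ C : ℝ, 0 < C → ∀ ε : ℝ, 0 < ε → ∃ C' : ℝ, 0 < C' ∧
    ∀ (q : ℕ) [NeZero q] (R M : ℝ), 1 ≤ R → R ≤ M → M ≤ (q : ℝ) ^ C →
    ∀ b : ℕ → ℕ → ℂ, (∀ r m, ‖b r m‖ ≤ 1) →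
      (∀ r m, b r m ≠ 0 → (R ≤ r ∧ (r : ℝ) ≤ 2 * R) ∧ (M ≤ m ∧ (m : ℝ) ≤ 2 * M) ∧ m.Coprime q) →
      ∑ x : ZMod q, ‖∑ r ∈ Icc 1 ⌊2 * R⌋₊, ∑ m ∈ Icc 1 ⌊2 * M⌋₊,
          (if (r : ZMod q) * (m : ZMod q)⁻¹ = x then b r m else 0)‖ ^ 2 ≤
        C' * (q : ℝ) ^ ε * (R * M + R ^ 2 * M ^ 2 / q)

/-- **Lemma 8** (l.945–955). "For arbitrary `b_k` supported on `k ≍ K`,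
(26) `∑_{x mod q} |∑_{k ≍ K} b_k χ(k + x)|² ≪_ε q^ε (q + K) ∑_{k ≍ K} |b_k|²`", `χ` the primitive
quadratic character mod `q` (the proof uses "`χ` is quadratic" and the CRT factorisation:
`|∑_x χ(x+k)χ(x+ℓ)| ≪ (k−ℓ, q)`). Box `[K,2K]`, `K ≥ 1`. Named fact.
[claim: BondarenkoHeap2026, status: under-review] -/
def lemma8 : Prop :=
  ∀ ε : ℝ, 0 < ε → ∃ C : ℝ, 0 < C ∧
    ∀ (q : ℕ) [NeZero q] (χ : DirichletCharacter ℂ q), χ.IsPrimitive → χ.IsQuadratic →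
    ∀ (K : ℝ), 1 ≤ K → ∀ b : ℕ → ℂ, (∀ k, b k ≠ 0 → K ≤ k ∧ (k : ℝ) ≤ 2 * K) →
      ∑ x : ZMod q, ‖∑ k ∈ Icc 1 ⌊2 * K⌋₊, b k * χ ((k : ZMod q) + x)‖ ^ 2 ≤
        C * (q : ℝ) ^ ε * ((q : ℝ) + K) * ∑ k ∈ Icc 1 ⌊2 * K⌋₊, ‖b k‖ ^ 2

/-! ### §6.5: generalised Jacobi sums, (28), Lemma 9, Lemma 10 -/

/-- **The generalised Jacobi sum `T_ψ(y) = ∑*_{u mod q} χ(u + y) ψ̄(u)`** (l.1009), the sum over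
reduced residues `u`, `ψ̄(u) = conj (ψ u)`. [cite: BondarenkoHeap2026, §6.5, TeX l.1009] -/
def genJacobiSum {q : ℕ} [NeZero q] (χ ψ : DirichletCharacter ℂ q) (y : ZMod q) : ℂ :=
  ∑ u : (ZMod q)ˣ, χ ((u : ZMod q) + y) * (starRingEnd ℂ) (ψ u)

/-- `ψ̄(u) = ψ(u⁻¹)` on reduced residues (values of a Dirichlet character on units are unimodular).
[folklore] -/
private theorem starRingEnd_apply_unit {q : ℕ} [NeZero q] (ψ : DirichletCharacter ℂ q) (u : (ZMod q)ˣ) :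
    (starRingEnd ℂ) (ψ u) = ψ (↑u⁻¹ : ZMod q) := by
  have hnorm : ‖ψ u‖ = 1 := ψ.unit_norm_eq_one u
  have hmul : ψ (↑u⁻¹ : ZMod q) * ψ u = 1 := by
    rw [← map_mul, Units.inv_mul, map_one]
  have hne : ψ u ≠ 0 := fun h => by simp [h] at hnorm
  have hinv : ψ (↑u⁻¹ : ZMod q) = (ψ u)⁻¹ := eq_inv_of_mul_eq_one_left hmul
  have hconj : ψ u * (starRingEnd ℂ) (ψ u) = 1 := by
    rw [Complex.mul_conj, Complex.normSq_eq_norm_sq, hnorm]; norm_num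
  rw [hinv]
  exact (eq_inv_of_mul_eq_one_right hconj)

/-- **Orthogonality** (display before (28), l.1012): `∑_{ψ mod q} T_ψ(y) ψ(k) = φ(q) χ(k + y)` for
`(k, q) = 1`. PROVED (character orthogonality `∑_ψ ψ(u⁻¹)ψ(k) = φ(q)[u = k]`).
[cite: BondarenkoHeap2026, §6.5, TeX l.1012] -/
theorem sum_genJacobiSum_mul_apply {q : ℕ} [NeZero q] (χ : DirichletCharacter ℂ q) (y : ZMod q)
    (k : (ZMod q)ˣ) :
    ∑ ψ : DirichletCharacter ℂ q, genJacobiSum χ ψ y * ψ k =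
      (q.totient : ℂ) * χ ((k : ZMod q) + y) := by
  classical
  haveI : NeZero ((Monoid.exponent (ZMod q)ˣ : ℕ) : ℂ) :=
    ⟨Nat.cast_ne_zero.2 (Monoid.ExponentExists.of_finite (G := (ZMod q)ˣ)).exponent_ne_zero⟩
  calc ∑ ψ : DirichletCharacter ℂ q, genJacobiSum χ ψ y * ψ k
      = ∑ u : (ZMod q)ˣ, χ ((u : ZMod q) + y) *
          ∑ ψ : DirichletCharacter ℂ q, ψ ((u : ZMod q)⁻¹) * ψ k := by
        simp_rw [genJacobiSum, Finset.sum_mul, Finset.mul_sum]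
        rw [Finset.sum_comm]
        refine Finset.sum_congr rfl fun u _ => Finset.sum_congr rfl fun ψ _ => ?_
        rw [starRingEnd_apply_unit, ZMod.inv_coe_unit]; ring
    _ = ∑ u : (ZMod q)ˣ, χ ((u : ZMod q) + y) *
          (if (u : ZMod q) = k then (q.totient : ℂ) else 0) := by
        refine Finset.sum_congr rfl fun u _ => ?_
        rw [DirichletCharacter.sum_char_inv_mul_char_eq ℂ (Units.isUnit u) (k : ZMod q)]
    _ = (q.totient : ℂ) * χ ((k : ZMod q) + y) := by
        simp_rw [Units.val_inj, mul_ite, mul_zero]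
        rw [Finset.sum_ite_eq' Finset.univ k]
        simp [mul_comm]

/-- **(28)** (l.1019): when `a_k` is supported on `(k,q) = 1` ("we may assume that `(k,q) = 1` and
we retain this condition implicitly in the `a_k`", l.1004) and `b_m` on `(m,q) = 1` (l.887),
`E(K,M,R) = (1/φ(q)) ∑_{ψ mod q} (∑_{m,r} b_m c_r T_ψ(r m̄)) (∑_k a_k Λ(k) ψ(k))` — via
`χ(m)χ(km + r) = χ(k + r m̄)` (`χ(m)² = 1`, l.884) and orthogonality. PROVED; both signs `s`.
[cite: BondarenkoHeap2026, eq. (28), TeX l.1019] -/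
theorem corrSumE_eq_sum_characters {q : ℕ} [NeZero q] (χ : DirichletCharacter ℂ q)
    (hχ : χ.IsQuadratic) (s : ℤ) (K M R : ℝ) (a b c : ℝ → ℂ)
    (ha : ∀ k : ℕ, a k ≠ 0 → k.Coprime q) (hb : ∀ m : ℕ, b m ≠ 0 → m.Coprime q) :
    corrSumE χ s K M R a b c = (q.totient : ℂ)⁻¹ * ∑ ψ : DirichletCharacter ℂ q,
      (∑ m ∈ Icc 1 ⌊2 * M⌋₊, ∑ r ∈ Icc 1 ⌊2 * R⌋₊,
          b m * c r * genJacobiSum χ ψ (((s * r : ℤ) : ZMod q) * (m : ZMod q)⁻¹)) *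
        ∑ k ∈ Icc 1 ⌊2 * K⌋₊, a k * ((Λ k : ℝ) : ℂ) * ψ (k : ZMod q) := by
  classical
  have hφ : (q.totient : ℂ) ≠ 0 := Nat.cast_ne_zero.2 (Nat.totient_pos.2 (NeZero.pos q)).ne'
  -- the summand identity, term by term in `(k, m, r)`, after summing over `ψ`
  have key : ∀ k m r : ℕ,
      a k * ((Λ k : ℝ) : ℂ) * (b m * c r * (χ (m : ZMod q) * χ (((k : ℤ) * m + s * r : ℤ) : ZMod q))) =
        ∑ ψ : DirichletCharacter ℂ q, (q.totient : ℂ)⁻¹ *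
          (b m * c r * genJacobiSum χ ψ (((s * r : ℤ) : ZMod q) * (m : ZMod q)⁻¹) *
            (a k * ((Λ k : ℝ) : ℂ) * ψ (k : ZMod q))) := by
    intro k m r
    by_cases hak : a k = 0
    · simp [hak]
    by_cases hbm : b m = 0
    · simp [hbm]
    have hku : IsUnit (k : ZMod q) := (ZMod.isUnit_iff_coprime k q).mpr (ha k hak)
    have hmu : IsUnit (m : ZMod q) := (ZMod.isUnit_iff_coprime m q).mpr (hb m hbm)
    obtain ⟨ku, hku⟩ := hku
    set y : ZMod q := ((s * r : ℤ) : ZMod q) * (m : ZMod q)⁻¹ with hy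
    have horth : ∑ ψ : DirichletCharacter ℂ q, genJacobiSum χ ψ y * ψ (k : ZMod q) =
        (q.totient : ℂ) * χ ((k : ZMod q) + y) := by
      rw [← hku]; exact sum_genJacobiSum_mul_apply χ y ku
    have hχm : χ (m : ZMod q) * χ (m : ZMod q) = 1 := by
      rcases hχ (m : ZMod q) with h0 | h1 | h1
      · exact absurd h0 (hmu.map χ).ne_zero
      · rw [h1]; norm_num
      · rw [h1]; norm_num
    have hminv : (m : ZMod q) * (m : ZMod q)⁻¹ = 1 := ZMod.mul_inv_of_unit _ hmu
    have hcast : (((k : ℤ) * m + s * r : ℤ) : ZMod q) = (m : ZMod q) * ((k : ZMod q) + y) := by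
      rw [hy]; push_cast
      linear_combination (-(((s : ZMod q)) * (r : ZMod q))) * hminv
    calc a k * ((Λ k : ℝ) : ℂ) * (b m * c r * (χ (m : ZMod q) * χ (((k : ℤ) * m + s * r : ℤ) : ZMod q)))
        = a k * ((Λ k : ℝ) : ℂ) * (b m * c r * χ ((k : ZMod q) + y)) := by
          rw [hcast, map_mul, ← mul_assoc (χ (m : ZMod q)), hχm, one_mul]
      _ = (q.totient : ℂ)⁻¹ * (b m * c r *
            (∑ ψ : DirichletCharacter ℂ q, genJacobiSum χ ψ y * ψ (k : ZMod q)) *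
            (a k * ((Λ k : ℝ) : ℂ))) := by
          rw [horth]; field_simp
      _ = ∑ ψ : DirichletCharacter ℂ q, (q.totient : ℂ)⁻¹ *
            (b m * c r * genJacobiSum χ ψ y * (a k * ((Λ k : ℝ) : ℂ) * ψ (k : ZMod q))) := by
          simp only [Finset.mul_sum, Finset.sum_mul]
          exact Finset.sum_congr rfl fun ψ _ => by ring
  -- left side: distribute `a_k Λ(k)` into the `(m, r)` sum and apply `key`
  have lhs : corrSumE χ s K M R a b c = ∑ k ∈ Icc 1 ⌊2 * K⌋₊, ∑ m ∈ Icc 1 ⌊2 * M⌋₊,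
      ∑ r ∈ Icc 1 ⌊2 * R⌋₊, ∑ ψ : DirichletCharacter ℂ q, (q.totient : ℂ)⁻¹ *
        (b m * c r * genJacobiSum χ ψ (((s * r : ℤ) : ZMod q) * (m : ZMod q)⁻¹) *
          (a k * ((Λ k : ℝ) : ℂ) * ψ (k : ZMod q))) := by
    simp only [corrSumE, Finset.mul_sum]
    exact Finset.sum_congr rfl fun k _ => Finset.sum_congr rfl fun m _ =>
      Finset.sum_congr rfl fun r _ => key k m r
  -- right side: distribute into the same quadruple sum, in the order `ψ, m, r, k`
  have rhs : (q.totient : ℂ)⁻¹ * ∑ ψ : DirichletCharacter ℂ q,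
      (∑ m ∈ Icc 1 ⌊2 * M⌋₊, ∑ r ∈ Icc 1 ⌊2 * R⌋₊,
          b m * c r * genJacobiSum χ ψ (((s * r : ℤ) : ZMod q) * (m : ZMod q)⁻¹)) *
        ∑ k ∈ Icc 1 ⌊2 * K⌋₊, a k * ((Λ k : ℝ) : ℂ) * ψ (k : ZMod q) =
      ∑ ψ : DirichletCharacter ℂ q, ∑ k ∈ Icc 1 ⌊2 * K⌋₊, ∑ m ∈ Icc 1 ⌊2 * M⌋₊,
        ∑ r ∈ Icc 1 ⌊2 * R⌋₊, (q.totient : ℂ)⁻¹ *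
          (b m * c r * genJacobiSum χ ψ (((s * r : ℤ) : ZMod q) * (m : ZMod q)⁻¹) *
            (a k * ((Λ k : ℝ) : ℂ) * ψ (k : ZMod q))) := by
    simp only [Finset.mul_sum, Finset.sum_mul]
  rw [lhs, rhs]
  -- reorder `k, m, r, ψ` into `ψ, k, m, r`
  calc ∑ k ∈ Icc 1 ⌊2 * K⌋₊, ∑ m ∈ Icc 1 ⌊2 * M⌋₊, ∑ r ∈ Icc 1 ⌊2 * R⌋₊,
        ∑ ψ : DirichletCharacter ℂ q, (q.totient : ℂ)⁻¹ *
          (b m * c r * genJacobiSum χ ψ (((s * r : ℤ) : ZMod q) * (m : ZMod q)⁻¹) *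
            (a k * ((Λ k : ℝ) : ℂ) * ψ (k : ZMod q)))
      = ∑ k ∈ Icc 1 ⌊2 * K⌋₊, ∑ m ∈ Icc 1 ⌊2 * M⌋₊, ∑ ψ : DirichletCharacter ℂ q,
          ∑ r ∈ Icc 1 ⌊2 * R⌋₊, (q.totient : ℂ)⁻¹ *
            (b m * c r * genJacobiSum χ ψ (((s * r : ℤ) : ZMod q) * (m : ZMod q)⁻¹) *
              (a k * ((Λ k : ℝ) : ℂ) * ψ (k : ZMod q))) :=
        Finset.sum_congr rfl fun _ _ => Finset.sum_congr rfl fun _ _ => Finset.sum_comm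
    _ = ∑ k ∈ Icc 1 ⌊2 * K⌋₊, ∑ ψ : DirichletCharacter ℂ q, ∑ m ∈ Icc 1 ⌊2 * M⌋₊,
          ∑ r ∈ Icc 1 ⌊2 * R⌋₊, (q.totient : ℂ)⁻¹ *
            (b m * c r * genJacobiSum χ ψ (((s * r : ℤ) : ZMod q) * (m : ZMod q)⁻¹) *
              (a k * ((Λ k : ℝ) : ℂ) * ψ (k : ZMod q))) :=
        Finset.sum_congr rfl fun _ _ => Finset.sum_comm
    _ = ∑ ψ : DirichletCharacter ℂ q, ∑ k ∈ Icc 1 ⌊2 * K⌋₊, ∑ m ∈ Icc 1 ⌊2 * M⌋₊,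
        ∑ r ∈ Icc 1 ⌊2 * R⌋₊, (q.totient : ℂ)⁻¹ *
          (b m * c r * genJacobiSum χ ψ (((s * r : ℤ) : ZMod q) * (m : ZMod q)⁻¹) *
            (a k * ((Λ k : ℝ) : ℂ) * ψ (k : ZMod q))) := Finset.sum_comm

/-- **`q_ψ`** of (29) (l.1034): for square-free `q`, `q_ψ = q / s_ψ = ∏_{p ∣ q, ψ_p ≠ χ_p} p` is
the conductor of `χψ̄` (module docstring, item 5); defined as that conductor for every `q`.
[cite: BondarenkoHeap2026, eq. (29), TeX l.1034] -/
def jacobiConductor {q : ℕ} (χ ψ : DirichletCharacter ℂ q) : ℕ := (χ * ψ⁻¹).conductor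

/-- **`s_ψ = ∏_{p ∣ q, ψ_p = χ_p} p`** of (29), as `q / q_ψ` (equal to the printed product for
square-free `q`). [cite: BondarenkoHeap2026, eq. (29), TeX l.1034] -/
def jacobiComplement {q : ℕ} (χ ψ : DirichletCharacter ℂ q) : ℕ := q / jacobiConductor χ ψ

/-- **`λ_ψ = (χψ̄)|_{q_ψ}`** of (29): the primitive character (mod `q_ψ = cond(χψ̄)`) inducing `χψ̄`.
[cite: BondarenkoHeap2026, eq. (29), TeX l.1034] -/
def jacobiTwist {q : ℕ} (χ ψ : DirichletCharacter ℂ q) :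
    DirichletCharacter ℂ (jacobiConductor χ ψ) :=
  (χ * ψ⁻¹).primitiveCharacter

/-- **`J_{q_ψ}(ψ)`** of (30): the product over `p ∣ q_ψ` of the local Jacobi-type sums
`∑*_{u mod p} χ_p(u+1) ψ̄_p(u)` (proof of Lemma 9, l.1073), equivalently — by (30) at `r = m = 1`
and `c_s(1) = μ(s)` — `μ(s_ψ) · T_ψ(1)`; defined by the latter (module docstring, item 5).
[cite: BondarenkoHeap2026, eq. (30), TeX l.1041 and l.1073] -/
def jacobiFactor {q : ℕ} [NeZero q] (χ ψ : DirichletCharacter ℂ q) : ℂ :=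
  (μ (jacobiComplement χ ψ) : ℂ) * genJacobiSum χ ψ 1

/-- **Lemma 9, (30)–(31)** (l.1026–1048). "Suppose `q` is odd and square-free and decompose
`ψ = ∏_{p∣q} ψ_p`. Let (29) `s_ψ = ∏_{p∣q, ψ_p=χ_p} p`, `q_ψ = q/s_ψ`, `λ_ψ = (χψ̄)|_{q_ψ}`. Then
(30) `T_ψ(r m̄) = J_{q_ψ}(ψ) λ_ψ(r) conj(λ_ψ(m)) c_{s_ψ}(r)`, where `c_s` is the Ramanujan sum, and
(31) `|J_{q_ψ}(ψ)| ≤ √q_ψ`. For `ψ = ψ₀` or `χ`, we have `|J_{q_ψ}(ψ)| ≤ 1`." Here `r ≠ 0`,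
`(m,q) = 1` (the variables of `E`), `χ` the primitive quadratic character mod `q`, `c_s` the tree's
`ramanujanSum`. Named fact (CRT factorisation and the Gauss-sum evaluation of Jacobi sums).
[claim: BondarenkoHeap2026, status: under-review] -/
def lemma9_exact : Prop :=
  ∀ (q : ℕ) [NeZero q], Odd q → Squarefree q →
    ∀ (χ : DirichletCharacter ℂ q), χ.IsPrimitive → χ.IsQuadratic →
    ∀ (ψ : DirichletCharacter ℂ q),
      (∀ (r m : ℤ), r ≠ 0 → IsCoprime m q →
        genJacobiSum χ ψ ((r : ZMod q) * (m : ZMod q)⁻¹) =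
          jacobiFactor χ ψ * jacobiTwist χ ψ (r : ZMod (jacobiConductor χ ψ)) *
            (starRingEnd ℂ) (jacobiTwist χ ψ (m : ZMod (jacobiConductor χ ψ))) *
            ramanujanSum (jacobiComplement χ ψ) r) ∧
      ‖jacobiFactor χ ψ‖ ≤ Real.sqrt (jacobiConductor χ ψ) ∧
      (ψ = 1 ∨ ψ = χ → ‖jacobiFactor χ ψ‖ ≤ 1)

/-- **Lemma 9, (32)** (l.1049–1064). "Thus, for coefficients `b_m`, `c_r` of modulus at most `1`,
(32) `(1/φ(q)) |∑_{r ≍ R} ∑_{m ≍ M} c_r b_m T_ψ(r m̄)| ≪ q^ε RM · {q^{−1/2} (ψ ∉ {ψ₀, χ});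
q^{−1} (ψ ∈ {ψ₀, χ})}`. The bound (32) also holds for fundamental discriminant conductors with a
factor `4` or `8`" — so typed for every `q` with a primitive quadratic `χ`; `m` coprime to `q`,
boxes `[R,2R]`, `[M,2M]`, either sign of `r`. Named fact.
[claim: BondarenkoHeap2026, status: under-review] -/
def lemma9_bound : Prop :=
  ∀ ε : ℝ, 0 < ε → ∃ C : ℝ, 0 < C ∧
    ∀ (q : ℕ) [NeZero q] (χ : DirichletCharacter ℂ q), χ.IsPrimitive → χ.IsQuadratic →
    ∀ (ψ : DirichletCharacter ℂ q) (R M : ℝ), 1 ≤ R → 1 ≤ M → ∀ (s : ℤ), (s = 1 ∨ s = -1) →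
    ∀ (b c : ℕ → ℂ), (∀ m, ‖b m‖ ≤ 1) → (∀ r, ‖c r‖ ≤ 1) →
      (∀ m, b m ≠ 0 → (M ≤ m ∧ (m : ℝ) ≤ 2 * M) ∧ m.Coprime q) →
      (∀ r, c r ≠ 0 → R ≤ r ∧ (r : ℝ) ≤ 2 * R) →
      (q.totient : ℝ)⁻¹ *
          ‖∑ r ∈ Icc 1 ⌊2 * R⌋₊, ∑ m ∈ Icc 1 ⌊2 * M⌋₊,
              c r * b m * genJacobiSum χ ψ (((s * r : ℤ) : ZMod q) * (m : ZMod q)⁻¹)‖ ≤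
        C * (q : ℝ) ^ ε * (R * M) *
          (if ψ = 1 ∨ ψ = χ then (q : ℝ)⁻¹ else ((q : ℝ) ^ (1 / 2 : ℝ))⁻¹)

/-- **Lemma 10** (l.1108–1123). "Let `V` be a smooth function supported in `[1,2]` and suppose
that `‖V^{(j)}‖_∞ ≪_j q^ε`. If `K ≥ q^{7/3+2η}`, then
`∑_{ψ mod q, ψ ∉ {ψ₀,χ}} |∑_n Λ(n) ψ(n) V(n/K)| ≪_{η,ε} K q^ε`, where `ψ₀` is the principal
character" (`χ` the primitive quadratic character mod `q`; `q^ε`-convention of the module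
docstring, item 3: loss `q^{ε₁}` in the hypothesis, `q^ε` in the conclusion). Named fact (explicit
formula (34)–(35) and the zero-density input Proposition 2 at (38), `0 < b < min(1/6, 6η/7)`).
[claim: BondarenkoHeap2026, status: under-review] -/
def lemma10 : Prop :=
  ∀ η : ℝ, 0 < η → ∀ ε : ℝ, 0 < ε → ∃ ε₁ : ℝ, 0 < ε₁ ∧ ∀ A : ℕ → ℝ, ∃ C : ℝ, 0 < C ∧
    ∀ (q : ℕ) [NeZero q] (χ : DirichletCharacter ℂ q), χ.IsPrimitive → χ.IsQuadratic →
    ∀ (K : ℝ), (q : ℝ) ^ (7 / 3 + 2 * η) ≤ K →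
    ∀ (V : ℝ → ℂ), ContDiff ℝ ∞ V → (∀ x : ℝ, V x ≠ 0 → 1 ≤ x ∧ x ≤ 2) →
      (∀ (j : ℕ) (x : ℝ), ‖iteratedDeriv j V x‖ ≤ A j * (q : ℝ) ^ ε₁) →
      ∑ ψ ∈ (Finset.univ.filter fun ψ : DirichletCharacter ℂ q => ψ ≠ 1 ∧ ψ ≠ χ),
          ‖∑ n ∈ Icc 1 ⌊2 * K⌋₊, ((Λ n : ℝ) : ℂ) * ψ (n : ZMod q) * V ((n : ℝ) / K)‖ ≤
        C * K * (q : ℝ) ^ ε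

/-! ### Assembly inside §6 (proved): the three ranges cover every `K`, so (23) ∧ (27) ∧ (40) give
a uniform power saving `q^{−η/4} = q^{−δ/40}` -/

/-- Monotonicity of the weight class `IsSmoothDyadicWeight X A Q` in the loss parameter `Q` (a
smaller admissible `q^ε` is a sub-class; used to combine the three ranges).
[cite: BondarenkoHeap2026, §6.2, TeX l.834–836] -/
theorem IsSmoothDyadicWeight.mono {X : ℝ} {A : ℕ → ℝ} {Q Q' : ℝ} {a : ℝ → ℂ}
    (h : IsSmoothDyadicWeight X A Q a) (hX : 0 < X) (hQ : 0 < Q) (hQQ' : Q ≤ Q') :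
    IsSmoothDyadicWeight X A Q' a := by
  refine ⟨h.1, h.2.1, h.2.2.1, fun j x => ?_⟩
  have hj := h.2.2.2 j x
  have hXj : 0 < X ^ j := pow_pos hX j
  rcases le_or_gt 0 (A j) with hA | hA
  · exact hj.trans (div_le_div_of_nonneg_right (mul_le_mul_of_nonneg_left hQQ' hA) hXj.le)
  · exact absurd (hj.trans_lt (div_neg_of_neg_of_pos (mul_neg_of_neg_of_pos hA hQ) hXj))
      (not_lt.2 (norm_nonneg _))

/-- **The ranges (20)–(22) exhaust `K ≥ 1`** for `0 < δ` (II and III overlap: `2η < δ − η` with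
`η = δ/10`, l.861). [cite: BondarenkoHeap2026, §6.2, TeX l.853–861] -/
theorem inRange_cases {δ : ℝ} (hδ : 0 < δ) {q : ℕ} (hq : 1 ≤ q) (K : ℝ) :
    InRangeI δ q K ∨ InRangeII δ q K ∨ InRangeIII δ q K := by
  by_cases h1 : InRangeI δ q K
  · exact Or.inl h1
  by_cases h2 : K ≤ (q : ℝ) ^ (7 / 3 + δ) * (q : ℝ) ^ (-(δ / 10))
  · exact Or.inr (Or.inl ⟨lt_of_not_ge h1, h2⟩)
  refine Or.inr (Or.inr ?_)
  have hq' : (1 : ℝ) ≤ q := by exact_mod_cast hq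
  have hle : (q : ℝ) ^ (7 / 3 + 2 * (δ / 10)) ≤ (q : ℝ) ^ (7 / 3 + δ) * (q : ℝ) ^ (-(δ / 10)) := by
    rw [← Real.rpow_add (by positivity)]
    exact Real.rpow_le_rpow_of_exponent_le hq' (by linarith)
  exact hle.trans (le_of_lt (lt_of_not_ge h2))

/-- **"Combining the power savings from all three ranges: (23), (27) and (40)"** (l.1309): for
`0 < δ < 10^{−2}` the three range bounds give `|E(K,M,R)| ≤ C · KM · q^{−δ/40}` (`= q^{−η/4}`, the
weakest of `q^{−η/2}`, `q^{−η/4}`, `q^{−δ/2}`) on every admissible scale. PROVED bookkeeping; the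
§6.2 reduction to Proposition 6 is not in this file. [cite: BondarenkoHeap2026, §6.5, TeX l.1309] -/
theorem corrSumPowerSaving_of_ranges (h₁ : rangeI_bound) (h₂ : rangeII_bound)
    (h₃ : rangeIII_bound) {δ : ℝ} (hδ : 0 < δ) (hδ' : δ < 1 / 100) :
    CorrSumPowerSaving δ (δ / 40) := by
  intro C₀ hC₀ A
  obtain ⟨e₁, he₁, C₁, hC₁, H₁⟩ := h₁ δ hδ hδ' C₀ hC₀ A
  obtain ⟨e₂, he₂, C₂, hC₂, H₂⟩ := h₂ δ hδ hδ' C₀ hC₀ A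
  obtain ⟨e₃, he₃, C₃, hC₃, H₃⟩ := h₃ δ hδ hδ' C₀ hC₀ A
  refine ⟨min e₁ (min e₂ e₃), lt_min he₁ (lt_min he₂ he₃), C₁ + C₂ + C₃, by positivity, ?_⟩
  intro q _ χ hχp hχq K M R hadm _ s hs a b c ha hb hc
  have hq1 : (1 : ℝ) ≤ q := by exact_mod_cast NeZero.one_le
  have hK : 0 < K := by linarith [hadm.1]
  have hM : 0 < M := by linarith [hadm.2.1]
  have hR : 0 < R := by linarith [hadm.2.2.1]
  -- weights of loss `q^{min}` are weights of loss `q^{eᵢ}`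
  have hpow : ∀ e : ℝ, min e₁ (min e₂ e₃) ≤ e →
      (0 : ℝ) < (q : ℝ) ^ min e₁ (min e₂ e₃) ∧ (q : ℝ) ^ min e₁ (min e₂ e₃) ≤ (q : ℝ) ^ e :=
    fun e he => ⟨by positivity, Real.rpow_le_rpow_of_exponent_le hq1 he⟩
  have hw : ∀ (e : ℝ), min e₁ (min e₂ e₃) ≤ e → ∀ {X : ℝ} {w : ℝ → ℂ}, 0 < X →
      IsSmoothDyadicWeight X A ((q : ℝ) ^ min e₁ (min e₂ e₃)) w →
      IsSmoothDyadicWeight X A ((q : ℝ) ^ e) w :=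
    fun e he X w hX h => h.mono hX (hpow e he).1 (hpow e he).2
  -- comparison of the three savings with `q^{-δ/40}`
  have hexp : ∀ θ : ℝ, δ / 40 ≤ θ → (q : ℝ) ^ (-θ) ≤ (q : ℝ) ^ (-(δ / 40)) :=
    fun θ hθ => Real.rpow_le_rpow_of_exponent_le hq1 (by linarith)
  have hfin : ∀ (Cᵢ θ : ℝ), 0 < Cᵢ → Cᵢ ≤ C₁ + C₂ + C₃ → δ / 40 ≤ θ →
      ‖corrSumE χ s K M R a b c‖ ≤ Cᵢ * (K * M) * (q : ℝ) ^ (-θ) →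
      ‖corrSumE χ s K M R a b c‖ ≤ (C₁ + C₂ + C₃) * (K * M) * (q : ℝ) ^ (-(δ / 40)) := by
    intro Cᵢ θ hCᵢ hle hθ h
    refine h.trans ?_
    have h0 : (0 : ℝ) ≤ (q : ℝ) ^ (-θ) := by positivity
    calc Cᵢ * (K * M) * (q : ℝ) ^ (-θ) ≤ (C₁ + C₂ + C₃) * (K * M) * (q : ℝ) ^ (-θ) := by
          gcongr
      _ ≤ (C₁ + C₂ + C₃) * (K * M) * (q : ℝ) ^ (-(δ / 40)) :=
          mul_le_mul_of_nonneg_left (hexp θ hθ) (by positivity)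
  rcases inRange_cases hδ (NeZero.one_le : 1 ≤ q) K with hI | hII | hIII
  · have he : min e₁ (min e₂ e₃) ≤ e₁ := min_le_left _ _
    exact hfin C₁ (δ / 10 / 2) hC₁ (by linarith) (by linarith)
      (H₁ q χ hχp hχq K M R hadm hI s hs a b c (hw e₁ he hK ha) (hw e₁ he hM hb) (hw e₁ he hR hc))
  · have he : min e₁ (min e₂ e₃) ≤ e₂ := (min_le_right _ _).trans (min_le_left _ _)
    exact hfin C₂ (δ / 10 / 4) hC₂ (by linarith) (by linarith)
      (H₂ q χ hχp hχq K M R hadm hII s hs a b c (hw e₂ he hK ha) (hw e₂ he hM hb) (hw e₂ he hR hc))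
  · have he : min e₁ (min e₂ e₃) ≤ e₃ := (min_le_right _ _).trans (min_le_right _ _)
    exact hfin C₃ (δ / 2) hC₃ (by linarith) (by linarith)
      (H₃ q χ hχp hχq K M R hadm hIII s hs a b c (hw e₃ he hK ha) (hw e₃ he hM hb) (hw e₃ he hR hc))

end Literature.NumberTheory.LFunctions.BondarenkoHeap2026
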